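import Literature.NumberTheory.DiophantineGeometry.GenEllThm21Rat
import Literature.NumberTheory.DiophantineGeometry.GenEllJInvReduction
import Literature.NumberTheory.DiophantineGeometry.GenEllJInvReductionProofs
import Summits.ABC.IUTFork.GenEllAbc
import HarnessLib

/-!
# Campaign-S endpoint, final form: `[IUTchIV] Cor 2.2 ⟹ ABC` modulo two CLASSICAL named facts, and
# `VojtaP1Deg 1 ↔ ABC`

Companion of `GenEllAbc.lean` (abc-iut cell, campaign S, TRANCHE-T1 P06; takes no side in the IUT
dispute, asserts nothing disputed):

* `abc_of_corollary22_of_krasner` — the hypothesis `hwlog` of `GenEllAbc.abc_of_corollary22` (the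
  "WLOG (∗^{j-inv})" sentence of the proof of [IUTchIV] Cor. 2.3, p. 55) is DISCHARGED by
  `GenEll.wlog_jInv_of_krasner` (`GenEllJInvReduction.lean`), so that, in the kernel,
  `Cor22.Corollary22 H_unif → ABC` modulo exactly the classical named facts [GenEll] Thm. 2.1
  (`GenEll_thm21`) and Krasner's finiteness of `p`-adic extensions of bounded degree
  (`krasner_finite_subextensions`), plus Cor. 2.2 itself (abc-iut-S3's typed predicate; disputed chain);
* `vojtaP1Deg_one_iff_ABC` — statement (i) of [GenEll] Thm. 2.1 for `(ℙ¹_ℚ, [0]+[1]+[∞])` at `d = 1`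
  is EQUIVALENT to the summit statement `ABC` (`GenEllThm21Rat.vojtaP1Deg_one_iff_abc`): the typed
  downstream end of chain S is calibrated — neither weaker nor stronger than `ABC`.

[cite: MochizukiGenEll2010, Thm 2.1 p.11]; [IUTchIV] Cor. 2.2–2.3 pp. 41–55
[claim: Mochizuki2012, status: disputed] (only the shape of the reduction is used);
Scholze–Stix 2018 §1.1 p. 1 [cite: ScholzeStix2018, §1.1 p. 1].
-/

namespace Summit.ABC.IUTFork

open Literature.NumberTheory.DiophantineGeometry.GenEll Literature.IUT.LogVolume

/-- **`[IUTchIV] Cor 2.2 ⟹ ABC` modulo two classical named facts**: granting [GenEll] Thm. 2.1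
(`hfact`) and Krasner's finiteness of extensions of `ℚ_p` of bounded degree (`hK`), the typed
[IUTchIV] Corollary 2.2 (`Cor22.Corollary22 H_unif`, abc-iut-S3; itself downstream of the disputed
[IUTchIII] Cor. 3.12 via Thm. 1.10) implies the summit statement `ABC`. PROVED bookkeeping:
`Cor22.bdLe_of_corollary22` (S3), `wlog_jInv_of_krasner`, `abc_of_abcCompactlyBounded`. TAKES NO SIDE.
RETIRED (audit A-Sd2-F1): `GenEll_thm21` without the prime binder is abc-strength as typed; the
declarations of record are `abc_of_corollary22_primes_of_krasner` / `ABC_of_corollary22_primes` below.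
[claim: Mochizuki2012, status: disputed] -/
theorem abc_of_corollary22_of_krasner (hfact : GenEll_thm21) (hK : krasner_finite_subextensions)
    {Hunif : ℝ} (h22 : Cor22.Corollary22 Hunif) : _root_.ABC :=
  abc_of_corollary22 hfact h22 (fun d ε => wlog_jInv_of_krasner hK d ε)

/-- **`VojtaP1Deg 1 ↔ ABC`**: statement (i) of [GenEll] Thm. 2.1 for the projective line minus three
points at degree `d = 1` (for every `ε > 0`, `ht_{ω_P(C)} ≲ (1+ε)(log-diff_P + log-cond_C)` on
`U_P(Q̄)^{≤1}`) is equivalent to the summit statement `ABC`. PROVED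
(`GenEllThm21Rat.vojtaP1Deg_one_iff_abc` + `ABC_iff`). [cite: MochizukiGenEll2010, Thm 2.1 p.11] -/
theorem vojtaP1Deg_one_iff_ABC : VojtaP1Deg 1 ↔ _root_.ABC := by
  rw [ABC_iff]
  exact vojtaP1Deg_one_iff_abc


/-! ## The endpoint over the FAITHFUL named fact `GenEll_thm21_primes` (audit A-Sd2-F1, append-only repair)

[GenEll] Thm. 2.1 reads "Let `Σ` be a finite set of prime numbers" (p. 11); the transcription
`GenEll_thm21` dropped that binder and is abc-strength by vacuity (audit A-Sd2-F1), so the theorems of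
record below take the faithful `GenEll_thm21_primes` (`GenEllThm21.lean`, p409822) through
`abc_of_corollary22_primes` (`GenEllAbc.lean`, p410187). -/

/-- **`[IUTchIV] Cor 2.2 ⟹ ABC` modulo two classical named facts — DECLARATION OF RECORD**: granting the
FAITHFUL [GenEll] Thm. 2.1 ((ii) ⟹ (i)|_{ℙ¹} for finite sets of PRIME numbers, `hfact : GenEll_thm21_primes`)
and Krasner's finiteness (`hK`), the typed [IUTchIV] Corollary 2.2 (`Cor22.Corollary22 H_unif`, abc-iut-S3;
disputed chain) implies the summit statement `ABC`. TAKES NO SIDE. [claim: Mochizuki2012, status: disputed] -/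
theorem abc_of_corollary22_primes_of_krasner (hfact : GenEll_thm21_primes)
    (hK : krasner_finite_subextensions) {Hunif : ℝ} (h22 : Cor22.Corollary22 Hunif) : _root_.ABC :=
  abc_of_corollary22_primes hfact h22 (fun d ε => wlog_jInv_of_krasner hK d ε)

/-- **`[IUTchIV] Cor 2.2 ⟹ ABC` modulo ONE classical named fact**: Krasner's finiteness is DISCHARGED in
the tree (abc-iut-S-d3's `krasner_finite_subextensions_holds` / `wlog_jInv`,
`GenEllJInvReductionProofs.lean`), so the typed Corollary 2.2 implies `ABC` granting only the FAITHFUL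
[GenEll] Thm. 2.1 (`GenEll_thm21_primes`). Upstream, `[IUTchIII] Cor 3.12 ⟹ Thm 1.10 ⟹ Cor 2.2` is the
disputed chain (typed by the Cor-3.12 crew and abc-iut-S3, never asserted). TAKES NO SIDE.
[claim: Mochizuki2012, status: disputed] -/
theorem ABC_of_corollary22_primes (hfact : GenEll_thm21_primes) {Hunif : ℝ}
    (h22 : Cor22.Corollary22 Hunif) : _root_.ABC :=
  abc_of_corollary22_primes hfact h22 (fun d ε => wlog_jInv d ε)

end Summit.ABC.IUTFork
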